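import Summits.CriticalPhenomena.PercolationContinuityZ3.Theorems.Transplant.FKDoubleFanBivector
import HarnessLib

/-!
# Double fans, same-apex pairs: the 27-facet INVARIANT CONE `𝒦*(q)` — definition, the axis bivector, the initial state, the final functional

Helper file (`--supports stmt-CriticalPhenomena-4575`), FK sub-lane `prim-bschramm-fk-3` (gen 24); builds on p205010 (kernel theorem, internal
audit signed; external expert review pending).  Pure real algebra: no measures, no named facts, no sorries; standard axioms.  Memo
`bschramm/prim-bschramm-fk-3/ALL-SAME-APEX.md` §6 and `SAME-APEX-LEAN.md`.

The polyhedral cone `𝒦*(q) ⊂ W ∧ V ≅ ℝ⁷` of the memo (§6) by its facet inequalities (**`InKstar`**; the duplicate facets `F₀ = −k`, `F₅ = b_x` are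
listed once, `f₂₇` is doubled): the ten `φ`-facets, the six cross facets, the facets `F_j = B̃ e_j` of the ten extreme rays `e_j(q)` of the
polyhedral relaxation `𝒫(q)` of the end vectors, and the closure facet `f₂₇`.  This file proves three of the four cone facts of the memo:
* (III) **`inKstar_negAxis`**: `−e_k ∈ 𝒦*` (`0 ≤ q ≤ 1`);
* (II) **`svec_inKstar`**: the initial mixed state `S(u) = T ω_u` lies in `𝒦*` for every valid `u` — each facet of `S(u)` is an explicit
  non-negative combination of the ten valid forms `ûŷ, (x̂−û)ŷ, (ẑ−û)ŷ, û(v̂−ŷ), (x̂−û)(v̂−ŷ), (ẑ−û)(v̂−ŷ), N^{(bc)}, N^{(ab)}, κ_B, κ_C` (lab `qcert2`);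
* (IV) **`fdot_nonneg_of_valid`**: the final functional is non-negative on the cone, `Fdot q s κ ≥ 0` for valid `s`, `κ ∈ 𝒦*`, `0 < q < 1`.  NEW ARGUMENT
  (the memo used the extreme-ray enumeration of `𝒫(q)`, not formalisable cheaply): for valid `s` the six products `m(s)` lie in the SEVEN-ray sub-cone
  `cone{e₁,e₂,e₃,e₅,e₆,e₈,e₁₀}` of `𝒫(q)` (one linear relation `e₈ + q(1−q)(e₁+e₆) = (1−q)(e₃+e₅) + q e₁₀`), with an explicit decomposition whose free
  parameter is chosen by a four-way case split (`Z_ab ≶ Z_bc`, sign of `N^{(ab)} − q ŷ Z_ab` resp. `N^{(bc)} − q ŷ Z_bc`); the coefficients are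
  `ŷû, ŷZ_bc, ŷZ_ab, Λ + Z_abZ_bc, N^{(ab)} − qŷZ_ab, N^{(bc)} − qŷZ_bc` (resp. `N^{(ab)}/q`, `(N^{(ab)} + qŷ(Z_bc−Z_ab))/q`, `Z_ab(Z_ab+Z_bc+Z_1)/(1−q)`, …),
  all `≥ 0` on the valid cone — so `F(s) = Σ_j ν_j(s) F_j` with `ν_j ≥ 0` and each `F_j ≥ 0` on `𝒦*`.
The invariance `L_M 𝒦* ⊆ 𝒦*` (I) is the next files (`…MixedConeInv*`).
[cite: Grimmett2006, §3.9 eq. (3.94) (pp. 63–64)] [folklore]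
-/

noncomputable section

namespace Summit.CriticalPhenomena.PercolationContinuityZ3.Theorems

namespace FK

namespace ThreeApex

/-! ### The cone -/

/-- **The invariant cone `𝒦*(q)`** of the memo (§6) by its facet inequalities, coordinates `(k, a_u, a_x, a_y, b_u, b_x, b_y)` of `W ∧ V`. [folklore] -/
structure InKstar (q : ℝ) (κ : K7) : Prop where
  /-- facet `phi1=-k` of the memo: `0 ≤ -κ.k` -/
  phi1 : 0 ≤ -κ.k
  /-- facet `phi2=-bu` of the memo: `0 ≤ -κ.bU` -/
  phi2 : 0 ≤ -κ.bU
  /-- facet `phi3=ax` of the memo: `0 ≤ κ.aX` -/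
  phi3 : 0 ≤ κ.aX
  /-- facet `phi4=-au` of the memo: `0 ≤ -κ.aU` -/
  phi4 : 0 ≤ -κ.aU
  /-- facet `phi5=(2-q)au-ay` of the memo: `0 ≤ (2 - q) * κ.aU - κ.aY` -/
  phi5 : 0 ≤ (2 - q) * κ.aU - κ.aY
  /-- facet `phi6=bx` of the memo: `0 ≤ κ.bX` -/
  phi6 : 0 ≤ κ.bX
  /-- facet `phi7=-R` of the memo: `0 ≤ -(2 - q) * κ.k - (1 - q) * κ.aX + (2 - q) * κ.bU + κ.bY` -/
  phi7 : 0 ≤ -(2 - q) * κ.k - (1 - q) * κ.aX + (2 - q) * κ.bU + κ.bY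
  /-- facet `phi9=2bu-k` of the memo: `0 ≤ -κ.k + 2 * κ.bU` -/
  phi9 : 0 ≤ -κ.k + 2 * κ.bU
  /-- facet `phi10=bu-k-ax` of the memo: `0 ≤ -κ.k - κ.aX + κ.bU` -/
  phi10 : 0 ≤ -κ.k - κ.aX + κ.bU
  /-- facet `phi11=-phi` of the memo: `0 ≤ -q * κ.k + (1 - q) * κ.aX - (2 - q) * κ.bU + κ.bY` -/
  phi11 : 0 ≤ -q * κ.k + (1 - q) * κ.aX - (2 - q) * κ.bU + κ.bY
  /-- facet `D1=au-bu` of the memo: `0 ≤ κ.aU - κ.bU` -/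
  d1 : 0 ≤ κ.aU - κ.bU
  /-- facet `D2=ay-k` of the memo: `0 ≤ -κ.k + κ.aY` -/
  d2 : 0 ≤ -κ.k + κ.aY
  /-- facet `D3` of the memo: `0 ≤ -κ.k - (2 - q) * κ.aU + κ.aY + (2 - q) * κ.bU` -/
  d3 : 0 ≤ -κ.k - (2 - q) * κ.aU + κ.aY + (2 - q) * κ.bU
  /-- facet `D4` of the memo: `0 ≤ -κ.k - 2 * κ.aU + κ.aY + 2 * κ.bU` -/
  d4 : 0 ≤ -κ.k - 2 * κ.aU + κ.aY + 2 * κ.bU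
  /-- facet `D5` of the memo: `0 ≤ -κ.k - κ.aU + κ.aY + κ.bU` -/
  d5 : 0 ≤ -κ.k - κ.aU + κ.aY + κ.bU
  /-- facet `D18` of the memo: `0 ≤ -κ.k + 2 * κ.aU - κ.aY + 2 * κ.bU` -/
  d18 : 0 ≤ -κ.k + 2 * κ.aU - κ.aY + 2 * κ.bU
  /-- facet `F1` of the memo: `0 ≤ (1 - q) * (2 - q) * κ.aU - (1 - q) * κ.aX - (1 - q) ^ 2 * κ.aY - (2 - q) * κ.bU + κ.bX + (1 - q) * κ.bY` -/
  fF1 : 0 ≤ (1 - q) * (2 - q) * κ.aU - (1 - q) * κ.aX - (1 - q) ^ 2 * κ.aY - (2 - q) * κ.bU + κ.bX + (1 - q) * κ.bY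
  /-- facet `F2` of the memo: `0 ≤ -q * κ.k + (1 - q) * κ.aY - (2 - q) * κ.bU + κ.bX` -/
  fF2 : 0 ≤ -q * κ.k + (1 - q) * κ.aY - (2 - q) * κ.bU + κ.bX
  /-- facet `F3` of the memo: `0 ≤ -κ.k - (1 - q) * κ.aX + (1 - q) * κ.aY - (2 - q) * κ.bU + 2 * κ.bX + (1 - q) * κ.bY` -/
  fF3 : 0 ≤ -κ.k - (1 - q) * κ.aX + (1 - q) * κ.aY - (2 - q) * κ.bU + 2 * κ.bX + (1 - q) * κ.bY
  /-- facet `F4` of the memo: `0 ≤ -(1 - q) * κ.aX - (2 - q) * κ.bU + 2 * κ.bX + (1 - q) * κ.bY` -/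
  fF4 : 0 ≤ -(1 - q) * κ.aX - (2 - q) * κ.bU + 2 * κ.bX + (1 - q) * κ.bY
  /-- facet `F6` of the memo: `0 ≤ (1 - q) ^ 2 * κ.aY - (2 - q) * κ.bU + (1 + q - q ^ 2) * κ.bX` -/
  fF6 : 0 ≤ (1 - q) ^ 2 * κ.aY - (2 - q) * κ.bU + (1 + q - q ^ 2) * κ.bX
  /-- facet `F7` of the memo: `0 ≤ -(1 - q) ^ 2 * κ.aX + (1 - q) ^ 2 * κ.aY - (2 - q) ^ 2 * κ.bU + (3 - 2 * q) * κ.bX + (1 - q) ^ 2 * κ.bY` -/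
  fF7 : 0 ≤ -(1 - q) ^ 2 * κ.aX + (1 - q) ^ 2 * κ.aY - (2 - q) ^ 2 * κ.bU + (3 - 2 * q) * κ.bX + (1 - q) ^ 2 * κ.bY
  /-- facet `F8` of the memo: `0 ≤ -(1 - q) ^ 2 * κ.aX - (2 - q) * κ.bU + (2 - q) * κ.bX + (1 - q) ^ 2 * κ.bY` -/
  fF8 : 0 ≤ -(1 - q) ^ 2 * κ.aX - (2 - q) * κ.bU + (2 - q) * κ.bX + (1 - q) ^ 2 * κ.bY
  /-- facet `F9` of the memo: `0 ≤ -(2 - q) * κ.bU + (2 - q) * κ.bX` -/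
  fF9 : 0 ≤ -(2 - q) * κ.bU + (2 - q) * κ.bX
  /-- facet `f27=D1oT21` of the memo: `0 ≤ -q * κ.k - (1 - q) * κ.aU + (1 - q) * κ.aX + κ.aY - κ.bU` -/
  f27 : 0 ≤ -q * κ.k - (1 - q) * κ.aU + (1 - q) * κ.aX + κ.aY - κ.bU

/-- (III) **The negative axis bivector `−e_k` lies in `𝒦*`** (`0 ≤ q ≤ 1`). [folklore] -/
theorem inKstar_negAxis {q : ℝ} (hq0 : 0 ≤ q) (hq1 : q ≤ 1) : InKstar q ⟨-1, 0, 0, 0, 0, 0, 0⟩ := by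
  have hq' : 0 ≤ 1 - q := sub_nonneg.2 hq1
  have h2q : 0 ≤ 2 - q := by linarith
  refine ⟨?_, ?_, ?_, ?_, ?_, ?_, ?_, ?_, ?_, ?_, ?_, ?_, ?_, ?_, ?_, ?_, ?_, ?_, ?_, ?_, ?_, ?_, ?_, ?_, ?_⟩ <;> norm_num <;> nlinarith

/-! ### (II) The initial state is in the cone -/

set_option maxHeartbeats 800000 in
/-- (II) **`S(u) ∈ 𝒦*(q)` for every valid `u`** (`0 ≤ q ≤ 1`). [folklore] -/
theorem svec_inKstar {q : ℝ} (hq0 : 0 ≤ q) (hq1 : q ≤ 1) {u : V5} (hu : Valid q u) : InKstar q (Svec q u) := by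
  obtain ⟨⟨hu0, hu1, hu2, hu3, hu4⟩, unac, unab, unbc, ulam, ukA, ukB, ukC⟩ := hu
  have hq' : 0 ≤ 1 - q := sub_nonneg.2 hq1
  have h2q : 0 ≤ 2 - q := by linarith
  refine ⟨?_, ?_, ?_, ?_, ?_, ?_, ?_, ?_, ?_, ?_, ?_, ?_, ?_, ?_, ?_, ?_, ?_, ?_, ?_, ?_, ?_, ?_, ?_, ?_, ?_⟩
  · -- phi1
    have h : 0 ≤ q * ((u.z0 + u.zac) * u.z0) + 2 * (u.zbc * (u.z0 + u.zac)) + q * (u.z0 * (u.zab + u.zbc + u.z1)) + 2 * (u.zbc * (u.zab + u.zbc + u.z1)) := by positivity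
    exact h.trans_eq (by simp only [Svec, V5.total]; ring)
  · -- phi2
    have h : 0 ≤ (u.zbc * (u.z0 + u.zac)) + (u.zbc * (u.zab + u.zbc + u.z1)) := by positivity
    exact h.trans_eq (by simp only [Svec, V5.total]; ring)
  · -- phi3
    have h : 0 ≤ q * ((u.z0 + u.zac) * u.z0) + q * (u.zab * (u.z0 + u.zac)) + masterN q (swapAB u) := by positivity
    exact h.trans_eq (by simp only [Svec, V5.total, masterN, swapAB]; ring)
  · -- phi4
    have h : 0 ≤ (u.zbc * (u.z0 + u.zac)) := by positivity
    exact h.trans_eq (by simp only [Svec, V5.total]; ring)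
  · -- phi5
    have h : 0 ≤ q * ((u.z0 + u.zac) * u.z0) + q * (u.zbc * (u.z0 + u.zac)) := by positivity
    exact h.trans_eq (by simp only [Svec, V5.total]; ring)
  · -- phi6
    have h : 0 ≤ q * ((u.z0 + u.zac) * u.z0) + q * (u.zab * (u.z0 + u.zac)) + q * (u.z0 * (u.zab + u.zbc + u.z1)) + q * (u.zab * (u.zab + u.zbc + u.z1)) := by positivity
    exact h.trans_eq (by simp only [Svec, V5.total]; ring)
  · -- phi7: identically zero
    exact (le_refl (0:ℝ)).trans_eq (by simp only [Svec, V5.total]; ring)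
  · -- phi9
    have h : 0 ≤ q * ((u.z0 + u.zac) * u.z0) + q * (u.z0 * (u.zab + u.zbc + u.z1)) := by positivity
    exact h.trans_eq (by simp only [Svec, V5.total]; ring)
  · -- phi10
    have h : 0 ≤ kap (swapAB u) := by positivity
    exact h.trans_eq (by simp only [Svec, V5.total, kap, swapAB]; ring)
  · -- phi11
    have h : 0 ≤ 2 * masterN q (swapAB u) := by positivity
    exact h.trans_eq (by simp only [Svec, V5.total, masterN, swapAB]; ring)
  · -- d1
    have h : 0 ≤ (u.zbc * (u.zab + u.zbc + u.z1)) := by positivity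
    exact h.trans_eq (by simp only [Svec, V5.total]; ring)
  · -- d2
    have h : 0 ≤ q * (u.z0 * (u.zab + u.zbc + u.z1)) + 2 * (u.zbc * (u.zab + u.zbc + u.z1)) := by positivity
    exact h.trans_eq (by simp only [Svec, V5.total]; ring)
  · -- d3
    have h : 0 ≤ q * (u.z0 * (u.zab + u.zbc + u.z1)) + q * (u.zbc * (u.zab + u.zbc + u.z1)) := by positivity
    exact h.trans_eq (by simp only [Svec, V5.total]; ring)
  · -- d4
    have h : 0 ≤ q * (u.z0 * (u.zab + u.zbc + u.z1)) := by positivity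
    exact h.trans_eq (by simp only [Svec, V5.total]; ring)
  · -- d5
    have h : 0 ≤ q * (u.z0 * (u.zab + u.zbc + u.z1)) + (u.zbc * (u.zab + u.zbc + u.z1)) := by positivity
    exact h.trans_eq (by simp only [Svec, V5.total]; ring)
  · -- d18
    have h : 0 ≤ (2 * q) * ((u.z0 + u.zac) * u.z0) + q * (u.z0 * (u.zab + u.zbc + u.z1)) := by positivity
    exact h.trans_eq (by simp only [Svec, V5.total]; ring)
  · -- fF1
    have h : 0 ≤ (q ^ 3) * ((u.z0 + u.zac) * u.z0) + (q ^ 2) * (u.zab * (u.z0 + u.zac)) + (q ^ 2) * (u.zbc * (u.z0 + u.zac)) + (q ^ 2) * (u.z0 * (u.zab + u.zbc + u.z1)) + q * (u.zab * (u.zab + u.zbc + u.z1)) + q * (u.zbc * (u.zab + u.zbc + u.z1)) := by positivity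
    exact h.trans_eq (by simp only [Svec, V5.total]; ring)
  · -- fF2
    have h : 0 ≤ (2 * q ^ 2) * ((u.z0 + u.zac) * u.z0) + q * (u.zab * (u.z0 + u.zac)) + (3 * q) * (u.zbc * (u.z0 + u.zac)) + (q + q ^ 2) * (u.z0 * (u.zab + u.zbc + u.z1)) + q * (u.zab * (u.zab + u.zbc + u.z1)) + (2 + q) * (u.zbc * (u.zab + u.zbc + u.z1)) := by positivity
    exact h.trans_eq (by simp only [Svec, V5.total]; ring)
  · -- fF3
    have h : 0 ≤ (3 * q ^ 2) * ((u.z0 + u.zac) * u.z0) + (q + q ^ 2) * (u.zab * (u.z0 + u.zac)) + (3 * q) * (u.zbc * (u.z0 + u.zac)) + (2 * q + q ^ 2) * (u.z0 * (u.zab + u.zbc + u.z1)) + (2 * q) * (u.zab * (u.zab + u.zbc + u.z1)) + (2 + q) * (u.zbc * (u.zab + u.zbc + u.z1)) := by positivity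
    exact h.trans_eq (by simp only [Svec, V5.total]; ring)
  · -- fF4
    have h : 0 ≤ (2 * q ^ 2) * ((u.z0 + u.zac) * u.z0) + (q + q ^ 2) * (u.zab * (u.z0 + u.zac)) + q * (u.zbc * (u.z0 + u.zac)) + (q + q ^ 2) * (u.z0 * (u.zab + u.zbc + u.z1)) + (2 * q) * (u.zab * (u.zab + u.zbc + u.z1)) + q * (u.zbc * (u.zab + u.zbc + u.z1)) := by positivity
    exact h.trans_eq (by simp only [Svec, V5.total]; ring)
  · -- fF6
    have h : 0 ≤ (3 * q ^ 2 * (1 - q) + q ^ 3) * ((u.z0 + u.zac) * u.z0) + (q * (1 - q) ^ 2 + 3 * q ^ 2 * (1 - q) + q ^ 3) * (u.zab * (u.z0 + u.zac)) + (3 * q * (1 - q) ^ 2 + 4 * q ^ 2 * (1 - q) + q ^ 3) * (u.zbc * (u.z0 + u.zac)) + (q * (1 - q) ^ 2 + 3 * q ^ 2 * (1 - q) + q ^ 3) * (u.z0 * (u.zab + u.zbc + u.z1)) + (q * (1 - q) ^ 2 + 3 * q ^ 2 * (1 - q) + q ^ 3) * (u.zab * (u.zab + u.zbc + u.z1)) +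 (2 * (1 - q) ^ 3 + 5 * q * (1 - q) ^ 2 + 4 * q ^ 2 * (1 - q) + q ^ 3) * (u.zbc * (u.zab + u.zbc + u.z1)) := by positivity
    exact h.trans_eq (by simp only [Svec, V5.total]; ring)
  · -- fF7
    have h : 0 ≤ (4 * q ^ 2 * (1 - q) + q ^ 3) * ((u.z0 + u.zac) * u.z0) + (2 * q * (1 - q) ^ 2 + 4 * q ^ 2 * (1 - q) + q ^ 3) * (u.zab * (u.z0 + u.zac)) + (4 * q * (1 - q) ^ 2 + 5 * q ^ 2 * (1 - q) + q ^ 3) * (u.zbc * (u.z0 + u.zac)) + (2 * q * (1 - q) ^ 2 + 4 * q ^ 2 * (1 - q) + q ^ 3) * (u.z0 * (u.zab + u.zbc + u.z1)) + (3 * q * (1 - q) ^ 2 + 4 * q ^ 2 * (1 - q) + q ^ 3) * (u.zab * (u.zab + u.zbc + u.z1)) + (2 * (1 - q) ^ 3 + 6 * q * (1 - q) ^ 2 + 5 * q ^ 2 * (1 - q) + q ^ 3) * (u.zbc * (u.zab + u.zbc + u.z1)) := by positivity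
    exact h.trans_eq (by simp only [Svec, V5.total]; ring)
  · -- fF8
    have h : 0 ≤ (3 * q ^ 2 * (1 - q) + q ^ 3) * ((u.z0 + u.zac) * u.z0) + (q * (1 - q) ^ 2 + 3 * q ^ 2 * (1 - q) + q ^ 3) * (u.zab * (u.z0 + u.zac)) + (3 * q * (1 - q) ^ 2 + 4 * q ^ 2 * (1 - q) + q ^ 3) * (u.zbc * (u.z0 + u.zac)) + (q * (1 - q) ^ 2 + 3 * q ^ 2 * (1 - q) + q ^ 3) * (u.z0 * (u.zab + u.zbc + u.z1)) + (2 * q * (1 - q) ^ 2 + 3 * q ^ 2 * (1 - q) + q ^ 3) * (u.zab * (u.zab + u.zbc + u.z1)) + (3 * q * (1 - q) ^ 2 + 4 * q ^ 2 * (1 - q) + q ^ 3) * (u.zbc * (u.zab + u.zbc + u.z1)) := by positivity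
    exact h.trans_eq (by simp only [Svec, V5.total]; ring)
  · -- fF9
    have h : 0 ≤ (2 * q * (1 - q) ^ 2 + 3 * q ^ 2 * (1 - q) + q ^ 3) * ((u.z0 + u.zac) * u.z0) + (2 * q * (1 - q) ^ 2 + 3 * q ^ 2 * (1 - q) + q ^ 3) * (u.zab * (u.z0 + u.zac)) + (2 * (1 - q) ^ 3 + 5 * q * (1 - q) ^ 2 + 4 * q ^ 2 * (1 - q) + q ^ 3) * (u.zbc * (u.z0 + u.zac)) + (2 * q * (1 - q) ^ 2 + 3 * q ^ 2 * (1 - q) + q ^ 3) * (u.z0 * (u.zab + u.zbc + u.z1)) + (2 * q * (1 - q) ^ 2 + 3 * q ^ 2 * (1 - q) + q ^ 3) * (u.zab * (u.zab + u.zbc + u.z1)) + (2 * (1 - q) ^ 3 + 5 * q * (1 - q) ^ 2 + 4 * q ^ 2 * (1 - q) + q ^ 3) * (u.zbc * (u.zab + u.zbc + u.z1)) := by positivity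
    exact h.trans_eq (by simp only [Svec, V5.total]; ring)
  · -- f27
    have h : 0 ≤ (q * (1 - q) ^ 2 + q ^ 2 * (1 - q)) * (u.zab * (u.z0 + u.zac)) + q * (u.zbc * (u.z0 + u.zac)) + (q ^ 2) * (u.z0 * (u.zab + u.zbc + u.z1)) + (1 + 2 * q) * (u.zbc * (u.zab + u.zbc + u.z1)) + ((1 - q) ^ 3 + 2 * q * (1 - q) ^ 2 + q ^ 2 * (1 - q)) * masterN q (swapAB u) := by positivity
    exact h.trans_eq (by simp only [Svec, V5.total, masterN, swapAB]; ring)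

/-! ### (IV) The final functional is non-negative on the cone -/

/-- The six-plus-one–ray decomposition of `m(s)` with free parameter `p` (coefficient of `e₈`):
`Fdot q s κ = ŷû·F₂(κ) + (N^{(bc)} − qŷZ_bc + q(1−q)p)·F₁(κ) + (ŷZ_bc − (1−q)p)·F₃(κ) + (ŷZ_ab − (1−q)p)·F₅(κ) + (N^{(ab)} − qŷZ_ab + q(1−q)p)·F₆(κ)
 + p·F₈(κ) + (Λ + Z_abZ_bc − qp)·F₁₀(κ)` (memo numbering of the rays; an identity for all `p`). [folklore] -/
theorem fdot_decomp (q p : ℝ) (s : V5) (κ : K7) :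
    Fdot q s κ =
      (s.z0 + s.zac) * s.z0 * ((1 - q) * (2 - q) * κ.aU - (1 - q) * κ.aX - (1 - q) ^ 2 * κ.aY - (2 - q) * κ.bU + κ.bX + (1 - q) * κ.bY)
      + (masterN q (swapAB s) - q * ((s.z0 + s.zac) * s.zbc) + q * (1 - q) * p) * (-κ.k)
      + ((s.z0 + s.zac) * s.zbc - (1 - q) * p) * (-q * κ.k + (1 - q) * κ.aY - (2 - q) * κ.bU + κ.bX)
      + ((s.z0 + s.zac) * s.zab - (1 - q) * p) * (-(1 - q) * κ.aX - (2 - q) * κ.bU + 2 * κ.bX + (1 - q) * κ.bY)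
      + (masterN q (swapBC s) - q * ((s.z0 + s.zac) * s.zab) + q * (1 - q) * p) * (κ.bX)
      + p * (-(1 - q) ^ 2 * κ.aX + (1 - q) ^ 2 * κ.aY - (2 - q) ^ 2 * κ.bU + (3 - 2 * q) * κ.bX + (1 - q) ^ 2 * κ.bY)
      + (lam s + s.zab * s.zbc - q * p) * (-(2 - q) * κ.bU + (2 - q) * κ.bX) := by
  simp only [Fdot, masterN, swapAB, swapBC, lam, V5.total]
  ring

/-- The two expressions of `N^{(bc)} − qŷZ_bc − (N^{(ab)} − qŷZ_ab) = (Z_bc − Z_ab)(Z_ab + Z_bc + Z_1)`. [folklore] -/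
theorem nbc_sub_nab_eq (q : ℝ) (s : V5) :
    masterN q (swapAB s) - q * ((s.z0 + s.zac) * s.zbc) - (masterN q (swapBC s) - q * ((s.z0 + s.zac) * s.zab)) =
      (s.zbc - s.zab) * (s.zab + s.zbc + s.z1) := by
  simp only [masterN, swapAB, swapBC]; ring

/-- `(1−q)(Λ + Z_abZ_bc) + N^{(ab)} − qŷZ_ab = Z_ab(Z_ab + Z_bc + Z_1)`. [folklore] -/
theorem lam_nab_eq (q : ℝ) (s : V5) :
    (1 - q) * (lam s + s.zab * s.zbc) + (masterN q (swapBC s) - q * ((s.z0 + s.zac) * s.zab)) = s.zab * (s.zab + s.zbc + s.z1) := by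
  simp only [masterN, swapBC, lam]; ring

/-- `(1−q)(Λ + Z_abZ_bc) + N^{(bc)} − qŷZ_bc = Z_bc(Z_ab + Z_bc + Z_1)`. [folklore] -/
theorem lam_nbc_eq (q : ℝ) (s : V5) :
    (1 - q) * (lam s + s.zab * s.zbc) + (masterN q (swapAB s) - q * ((s.z0 + s.zac) * s.zbc)) = s.zbc * (s.zab + s.zbc + s.z1) := by
  simp only [masterN, swapAB, lam]; ring

/-- Case `Z_ab ≤ Z_bc`, `N^{(ab)} ≤ qŷZ_ab`: the decomposition with `p = (qŷZ_ab − N^{(ab)})/(q(1−q))`, multiplied by `q(1−q)`. [folklore] -/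
theorem fdot_decomp_A (q : ℝ) (s : V5) (κ : K7) :
    q * (1 - q) * Fdot q s κ =
      q * (1 - q) * ((s.z0 + s.zac) * s.z0) * ((1 - q) * (2 - q) * κ.aU - (1 - q) * κ.aX - (1 - q) ^ 2 * κ.aY - (2 - q) * κ.bU + κ.bX + (1 - q) * κ.bY)
      + q * (1 - q) * ((s.zbc - s.zab) * (s.zab + s.zbc + s.z1)) * (-κ.k)
      + (1 - q) * (masterN q (swapBC s) + q * ((s.z0 + s.zac) * (s.zbc - s.zab))) * (-q * κ.k + (1 - q) * κ.aY - (2 - q) * κ.bU + κ.bX)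
      + (1 - q) * masterN q (swapBC s) * (-(1 - q) * κ.aX - (2 - q) * κ.bU + 2 * κ.bX + (1 - q) * κ.bY)
      + (q * ((s.z0 + s.zac) * s.zab) - masterN q (swapBC s)) * (-(1 - q) ^ 2 * κ.aX + (1 - q) ^ 2 * κ.aY - (2 - q) ^ 2 * κ.bU + (3 - 2 * q) * κ.bX + (1 - q) ^ 2 * κ.bY)
      + q * (s.zab * (s.zab + s.zbc + s.z1)) * (-(2 - q) * κ.bU + (2 - q) * κ.bX) := by
  simp only [Fdot, masterN, swapBC, V5.total]
  ring

/-- Case `Z_bc ≤ Z_ab`, `N^{(bc)} ≤ qŷZ_bc`: the decomposition with `p = (qŷZ_bc − N^{(bc)})/(q(1−q))`, multiplied by `q(1−q)`. [folklore] -/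
theorem fdot_decomp_B (q : ℝ) (s : V5) (κ : K7) :
    q * (1 - q) * Fdot q s κ =
      q * (1 - q) * ((s.z0 + s.zac) * s.z0) * ((1 - q) * (2 - q) * κ.aU - (1 - q) * κ.aX - (1 - q) ^ 2 * κ.aY - (2 - q) * κ.bU + κ.bX + (1 - q) * κ.bY)
      + (1 - q) * masterN q (swapAB s) * (-q * κ.k + (1 - q) * κ.aY - (2 - q) * κ.bU + κ.bX)
      + (1 - q) * (masterN q (swapAB s) + q * ((s.z0 + s.zac) * (s.zab - s.zbc))) * (-(1 - q) * κ.aX - (2 - q) * κ.bU + 2 * κ.bX + (1 - q) * κ.bY)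
      + q * (1 - q) * ((s.zab - s.zbc) * (s.zab + s.zbc + s.z1)) * (κ.bX)
      + (q * ((s.z0 + s.zac) * s.zbc) - masterN q (swapAB s)) * (-(1 - q) ^ 2 * κ.aX + (1 - q) ^ 2 * κ.aY - (2 - q) ^ 2 * κ.bU + (3 - 2 * q) * κ.bX + (1 - q) ^ 2 * κ.bY)
      + q * (s.zbc * (s.zab + s.zbc + s.z1)) * (-(2 - q) * κ.bU + (2 - q) * κ.bX) := by
  simp only [Fdot, masterN, swapAB, V5.total]
  ring

set_option maxHeartbeats 800000 in
/-- (IV) **The final functional is non-negative on the cone**: `Fdot q s κ ≥ 0` for valid `s`, `κ ∈ 𝒦*(q)`, `0 < q < 1`. [folklore] -/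
theorem fdot_nonneg_of_valid {q : ℝ} (hq0 : 0 < q) (hq1 : q < 1) {s : V5} (hs : Valid q s) {κ : K7} (hκ : InKstar q κ) :
    0 ≤ Fdot q s κ := by
  obtain ⟨⟨hs0, hs1, hs2, hs3, hs4⟩, snac, snab, snbc, slam, skA, skB, skC⟩ := hs
  have hq' : 0 < 1 - q := sub_pos.2 hq1
  have hqq : 0 < q * (1 - q) := mul_pos hq0 hq'
  have hF1 := hκ.fF1; have hF0 := hκ.phi1; have hF2 := hκ.fF2; have hF4 := hκ.fF4; have hF5 := hκ.phi6; have hF7 := hκ.fF7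
  have hF9 := hκ.fF9
  have hy : 0 ≤ s.z0 + s.zac := by positivity
  have hyu : 0 ≤ (s.z0 + s.zac) * s.z0 := by positivity
  have hlam : 0 ≤ lam s + s.zab * s.zbc := by positivity
  have hsum : 0 ≤ s.zab + s.zbc + s.z1 := by positivity
  have hdiff := nbc_sub_nab_eq q s
  rcases le_total s.zab s.zbc with hab | hba
  · -- `Z_ab ≤ Z_bc`
    have hd : 0 ≤ (s.zbc - s.zab) * (s.zab + s.zbc + s.z1) := mul_nonneg (sub_nonneg.2 hab) hsum
    rcases le_total 0 (masterN q (swapBC s) - q * ((s.z0 + s.zac) * s.zab)) with hA0 | hA1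
    · -- free parameter `p = 0`
      have hnu1 : 0 ≤ masterN q (swapAB s) - q * ((s.z0 + s.zac) * s.zbc) := by linarith
      rw [fdot_decomp q 0 s κ]
      simp only [mul_zero, zero_mul, add_zero, sub_zero]
      have t1 := mul_nonneg hyu hF1
      have t0 := mul_nonneg hnu1 hF0
      have t2 := mul_nonneg (mul_nonneg hy hs3) hF2
      have t4 := mul_nonneg (mul_nonneg hy hs1) hF4
      have t5 := mul_nonneg hA0 hF5
      have t9 := mul_nonneg hlam hF9
      linarith [t1, t0, t2, t4, t5, t9]
    · -- free parameter `p = (qŷZ_ab − N^{(ab)})/(q(1−q))`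
      have key : 0 ≤ q * (1 - q) * Fdot q s κ := by
        rw [fdot_decomp_A]
        have hc2 : 0 ≤ masterN q (swapBC s) + q * ((s.z0 + s.zac) * (s.zbc - s.zab)) := by
          have := mul_nonneg (mul_nonneg hq0.le hy) (sub_nonneg.2 hab); linarith
        have t1 := mul_nonneg (mul_nonneg hqq.le hyu) hF1
        have t0 := mul_nonneg (mul_nonneg hqq.le hd) hF0
        have t2 := mul_nonneg (mul_nonneg hq'.le hc2) hF2
        have t4 := mul_nonneg (mul_nonneg hq'.le snab) hF4
        have t7 := mul_nonneg (sub_nonneg.2 (sub_nonpos.1 hA1)) hF7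
        have t9 := mul_nonneg (mul_nonneg hq0.le (mul_nonneg hs1 hsum)) hF9
        linarith
      exact le_of_mul_le_mul_left (by rw [mul_zero]; exact key) hqq
  · -- `Z_bc ≤ Z_ab` (mirror image)
    have hd : 0 ≤ (s.zab - s.zbc) * (s.zab + s.zbc + s.z1) := mul_nonneg (sub_nonneg.2 hba) hsum
    rcases le_total 0 (masterN q (swapAB s) - q * ((s.z0 + s.zac) * s.zbc)) with hB0 | hB1
    · -- free parameter `p = 0`
      have hnu6 : 0 ≤ masterN q (swapBC s) - q * ((s.z0 + s.zac) * s.zab) := by nlinarith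
      rw [fdot_decomp q 0 s κ]
      simp only [mul_zero, zero_mul, add_zero, sub_zero]
      have t1 := mul_nonneg hyu hF1
      have t0 := mul_nonneg hB0 hF0
      have t2 := mul_nonneg (mul_nonneg hy hs3) hF2
      have t4 := mul_nonneg (mul_nonneg hy hs1) hF4
      have t5 := mul_nonneg hnu6 hF5
      have t9 := mul_nonneg hlam hF9
      linarith [t1, t0, t2, t4, t5, t9]
    · -- free parameter `p = (qŷZ_bc − N^{(bc)})/(q(1−q))`
      have key : 0 ≤ q * (1 - q) * Fdot q s κ := by
        rw [fdot_decomp_B]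
        have hc4 : 0 ≤ masterN q (swapAB s) + q * ((s.z0 + s.zac) * (s.zab - s.zbc)) := by
          have := mul_nonneg (mul_nonneg hq0.le hy) (sub_nonneg.2 hba); linarith
        have t1 := mul_nonneg (mul_nonneg hqq.le hyu) hF1
        have t2 := mul_nonneg (mul_nonneg hq'.le snbc) hF2
        have t4 := mul_nonneg (mul_nonneg hq'.le hc4) hF4
        have t5 := mul_nonneg (mul_nonneg hqq.le hd) hF5
        have t7 := mul_nonneg (sub_nonneg.2 (sub_nonpos.1 hB1)) hF7
        have t9 := mul_nonneg (mul_nonneg hq0.le (mul_nonneg hs3 hsum)) hF9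
        linarith
      exact le_of_mul_le_mul_left (by rw [mul_zero]; exact key) hqq

end ThreeApex

end FK

end Summit.CriticalPhenomena.PercolationContinuityZ3.Theorems
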